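import Mathlib

/-!
# SoloInformedProjectiveDesignCount — counting lemmas for matrix-multiplication designs in incidence structures

Solo-informed programme (MatrixMultiplication), gen 101; first half of the projective-design bound
(`SoloInformedProjectiveDesignBound`), door D13 of the dossier (Cohn–Umans 2013, arXiv:1207.6528,
Conjecture 21: commutative coherent configurations realizing `⟨n,n,n⟩`).

Setting: a finite incidence structure `inc : P → L → Prop` (points, lines); for a map `f : X → P` and
a line `l`, `a_l = #{x | inc (f x) l}` is the number of indices whose point lies on `l`; the analogous
filters count the lines through one, two or three given points (all written out as `Finset.card` of
`univ.filter`, no auxiliary definitions).  A triple of maps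
`α β γ : Fin n × Fin n → P` is a *design* when every pairwise-distinct collinear transversal
`(α x, β y, γ z)` is matched (`y.1 = x.2 ∧ z = (y.2, x.1)`, i.e. `x = (a,b)`, `y = (b,c)`, `z = (c,a)`).

## Results

* `sum_cnt`, `sum_cnt_sq`, `sum_cnt_mul_cnt_mul_cnt` — double-counting identities for `∑_L a_L`,
  `∑_L a_L²`, `∑_L a_L b_L c_L`.
* `common₃_le_indicators` — pointwise: under the design hypothesis and "two distinct points lie on
  exactly one line, every point on `q+1` lines", the number of common lines of a transversal is at most
  `[matched] + [α x = β y] + [γ z = α x] + [γ z = β y] + q·[α x = β y = γ z]`.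
* `sum_common₃_le` — UPPER COUNT `∑_{x,y,z} common₃ ≤ n³ + 3n⁴ + q n²` (`β`, `γ` injective).
* `moments` — `∑_L a_L = n²(q+1)` and `∑_L a_L² = n²(n²+q)` for an injective colouring.
-/

namespace Summit.MatrixMultiplication.MatrixMultiplication.Theorems.ProjectiveDesign

open Finset

section Counting

variable {P L : Type*} [Fintype L]
variable (inc : P → L → Prop) [DecidableRel inc]

/-- Product of two `0/1` indicators is the indicator of the conjunction. -/
lemma ind_mul_ind (a b : Prop) [Decidable a] [Decidable b] :
    (if a then (1:ℕ) else 0) * (if b then 1 else 0) = if (a ∧ b) then 1 else 0 := by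
  by_cases ha : a <;> by_cases hb : b <;> simp [ha, hb]

omit [Fintype L] in
/-- The count `a_l` as a sum of indicators. -/
lemma cnt_eq_sum {X : Type*} [Fintype X] (f : X → P) (l : L) :
    (univ.filter (fun x => inc (f x) l)).card = ∑ x : X, (if inc (f x) l then 1 else 0) := by
  rw [card_filter]

/-- `∑_L a_L = ∑_x #(lines through f x)`. -/
lemma sum_cnt {X : Type*} [Fintype X] (f : X → P) :
    ∑ l : L, (univ.filter (fun x => inc (f x) l)).card =
      ∑ x : X, (univ.filter (fun l => inc (f x) l)).card := by
  simp only [card_filter]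
  exact Finset.sum_comm

/-- `∑_L a_L² = ∑_{x,x'} #(lines through f x and f x')`. -/
lemma sum_cnt_sq {X : Type*} [Fintype X] (f : X → P) :
    ∑ l : L, ((univ.filter (fun x => inc (f x) l)).card) ^ 2 =
      ∑ x : X, ∑ x' : X, (univ.filter (fun l => inc (f x) l ∧ inc (f x') l)).card := by
  have h : ∀ l : L, ((univ.filter (fun x => inc (f x) l)).card) ^ 2 =
      ∑ x : X, ∑ x' : X, (if (inc (f x) l ∧ inc (f x') l) then 1 else 0) := by
    intro l
    rw [sq, cnt_eq_sum, sum_mul_sum]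
    refine sum_congr rfl (fun x _ => sum_congr rfl (fun x' _ => ?_))
    exact ind_mul_ind _ _
  simp only [h]
  simp only [card_filter]
  rw [Finset.sum_comm]
  refine sum_congr rfl (fun x _ => ?_)
  rw [Finset.sum_comm]

/-- `∑_L a_L b_L c_L = ∑_{x,y,z} #(lines through α x, β y, γ z)`. -/
lemma sum_cnt_mul_cnt_mul_cnt {X Y Z : Type*} [Fintype X] [Fintype Y] [Fintype Z]
    (α : X → P) (β : Y → P) (γ : Z → P) :
    ∑ l : L, (univ.filter (fun x => inc (α x) l)).card * (univ.filter (fun x => inc (β x) l)).card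
        * (univ.filter (fun x => inc (γ x) l)).card =
      ∑ x : X, ∑ y : Y, ∑ z : Z, (univ.filter (fun l => inc (α x) l ∧ inc (β y) l ∧ inc (γ z) l)).card := by
  have h : ∀ l : L, (univ.filter (fun x => inc (α x) l)).card
      * (univ.filter (fun x => inc (β x) l)).card * (univ.filter (fun x => inc (γ x) l)).card =
      ∑ x : X, ∑ y : Y, ∑ z : Z,
        (if (inc (α x) l ∧ inc (β y) l ∧ inc (γ z) l) then 1 else 0) := by
    intro l
    rw [cnt_eq_sum, cnt_eq_sum, cnt_eq_sum, sum_mul_sum, sum_mul_sum]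
    refine sum_congr rfl (fun x _ => ?_)
    simp only [Finset.sum_mul]
    rw [Finset.sum_comm]
    refine sum_congr rfl (fun y _ => sum_congr rfl (fun z _ => ?_))
    rw [ind_mul_ind, ind_mul_ind]
    by_cases h1 : inc (α x) l <;> by_cases h2 : inc (β y) l <;> by_cases h3 : inc (γ z) l <;> simp [h1, h2, h3]
  simp only [h]
  simp only [card_filter]
  rw [Finset.sum_comm]
  refine sum_congr rfl (fun x _ => ?_)
  rw [Finset.sum_comm]
  refine sum_congr rfl (fun y _ => ?_)
  rw [Finset.sum_comm]

end Counting


section Main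

variable {P L : Type*} [Fintype L]
variable (inc : P → L → Prop) [DecidableRel inc]

/-- Lines through three points are among the lines through the first two. -/
lemma common₃_le_common₂_left (p₁ p₂ p₃ : P) :
    (univ.filter (fun l => inc p₁ l ∧ inc p₂ l ∧ inc p₃ l)).card ≤
      (univ.filter (fun l => inc p₁ l ∧ inc p₂ l)).card := by
  refine card_le_card (fun l hl => ?_)
  simp only [mem_filter, mem_univ, true_and] at hl ⊢
  exact ⟨hl.1, hl.2.1⟩

/-- Lines through three points are among the lines through the first and third. -/
lemma common₃_le_common₂_right (p₁ p₂ p₃ : P) :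
    (univ.filter (fun l => inc p₁ l ∧ inc p₂ l ∧ inc p₃ l)).card ≤
      (univ.filter (fun l => inc p₁ l ∧ inc p₃ l)).card := by
  refine card_le_card (fun l hl => ?_)
  simp only [mem_filter, mem_univ, true_and] at hl ⊢
  exact ⟨hl.1, hl.2.2⟩

/-- Lines through two points are among the lines through the first. -/
lemma common₂_le_through (p₁ p₂ : P) :
    (univ.filter (fun l => inc p₁ l ∧ inc p₂ l)).card ≤ (univ.filter (fun l => inc p₁ l)).card := by
  refine card_le_card (fun l hl => ?_)
  simp only [mem_filter, mem_univ, true_and] at hl ⊢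
  exact hl.1

/-- The lines through `p` and `p` are the lines through `p`. -/
lemma common₂_self (p : P) :
    (univ.filter (fun l => inc p l ∧ inc p l)).card = (univ.filter (fun l => inc p l)).card := by
  congr 1
  ext l
  simp

/-- A positive count of common lines produces a common line. -/
lemma exists_of_common₃_pos {p₁ p₂ p₃ : P}
    (h : 0 < (univ.filter (fun l => inc p₁ l ∧ inc p₂ l ∧ inc p₃ l)).card) :
    ∃ l, inc p₁ l ∧ inc p₂ l ∧ inc p₃ l := by
  obtain ⟨l, hl⟩ := card_pos.mp h
  simp only [mem_filter, mem_univ, true_and] at hl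
  exact ⟨l, hl⟩

variable [DecidableEq P]

/-- For an injective colouring, at most one index has a given point. -/
lemma sum_ind_eq_le_one {X : Type*} [Fintype X] (f : X → P) (hf : Function.Injective f) (p : P) :
    ∑ y : X, (if p = f y then 1 else 0) ≤ 1 := by
  rw [← Finset.card_filter]
  refine Finset.card_le_one.mpr (fun y hy y' hy' => ?_)
  simp only [mem_filter, mem_univ, true_and] at hy hy'
  exact hf (hy.symm.trans hy')

/-- For an injective colouring, at most one index has a given point (reversed equation). -/
lemma sum_ind_eq_le_one' {X : Type*} [Fintype X] (f : X → P) (hf : Function.Injective f) (p : P) :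
    ∑ y : X, (if f y = p then 1 else 0) ≤ 1 := by
  rw [← Finset.card_filter]
  refine Finset.card_le_one.mpr (fun y hy y' hy' => ?_)
  simp only [mem_filter, mem_univ, true_and] at hy hy'
  exact hf (hy.trans hy'.symm)

variable {n : ℕ}

/-- POINTWISE BOUND on the number of common lines of a transversal, from the realization hypothesis:
pairwise-distinct collinear transversals are matched. -/
lemma common₃_le_indicators {q : ℕ}
    (hthrough : ∀ p : P, (univ.filter (fun l => inc p l)).card = q + 1)
    (hcommon : ∀ p p' : P, p ≠ p' → (univ.filter (fun l => inc p l ∧ inc p' l)).card = 1)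
    (α β γ : Fin n × Fin n → P)
    (hreal : ∀ x y z : Fin n × Fin n, α x ≠ β y → β y ≠ γ z → α x ≠ γ z →
        (∃ l, inc (α x) l ∧ inc (β y) l ∧ inc (γ z) l) → (y.1 = x.2 ∧ z = (y.2, x.1)))
    (x y z : Fin n × Fin n) :
    (univ.filter (fun l => inc (α x) l ∧ inc (β y) l ∧ inc (γ z) l)).card ≤
      (if (y.1 = x.2 ∧ z = (y.2, x.1)) then 1 else 0) + (if α x = β y then 1 else 0)
      + (if γ z = α x then 1 else 0) + (if γ z = β y then 1 else 0)
      + q * (if (α x = β y ∧ γ z = α x) then 1 else 0) := by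
  have hq1 : (univ.filter (fun l => inc (α x) l ∧ inc (β y) l ∧ inc (γ z) l)).card ≤ q + 1 := by
    calc (univ.filter (fun l => inc (α x) l ∧ inc (β y) l ∧ inc (γ z) l)).card
        ≤ (univ.filter (fun l => inc (α x) l ∧ inc (β y) l)).card := common₃_le_common₂_left inc _ _ _
      _ ≤ (univ.filter (fun l => inc (α x) l)).card := common₂_le_through inc _ _
      _ = q + 1 := hthrough _
  have hA : α x ≠ β y → (univ.filter (fun l => inc (α x) l ∧ inc (β y) l ∧ inc (γ z) l)).card ≤ 1 := by
    intro h
    have h' := common₃_le_common₂_left inc (α x) (β y) (γ z)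
    rwa [hcommon _ _ h] at h'
  have hB : γ z ≠ α x → (univ.filter (fun l => inc (α x) l ∧ inc (β y) l ∧ inc (γ z) l)).card ≤ 1 := by
    intro h
    have h' := common₃_le_common₂_right inc (α x) (β y) (γ z)
    rwa [hcommon _ _ (fun e => h e.symm)] at h'
  have hZ : α x ≠ β y → γ z ≠ α x → γ z ≠ β y → ¬ (y.1 = x.2 ∧ z = (y.2, x.1)) →
      (univ.filter (fun l => inc (α x) l ∧ inc (β y) l ∧ inc (γ z) l)).card = 0 := by
    intro h1 h2 h3 hM
    by_contra hne
    exact hM (hreal x y z h1 (fun e => h3 e.symm) (fun e => h2 e.symm)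
      (exists_of_common₃_pos inc (Nat.pos_of_ne_zero hne)))
  by_cases hM : (y.1 = x.2 ∧ z = (y.2, x.1)) <;> by_cases h1 : α x = β y <;>
    by_cases h2 : γ z = α x <;> by_cases h3 : γ z = β y
  all_goals (first | rw [if_pos hM] | rw [if_neg hM])
  all_goals (first | rw [if_pos h1] | rw [if_neg h1])
  all_goals (first | rw [if_pos h2] | rw [if_neg h2])
  all_goals (first | rw [if_pos h3] | rw [if_neg h3])
  all_goals (first
    | rw [if_pos (show α x = β y ∧ γ z = α x from ⟨h1, h2⟩)]
    | rw [if_neg (show ¬ (α x = β y ∧ γ z = α x) from fun h => h1 h.1)]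
    | rw [if_neg (show ¬ (α x = β y ∧ γ z = α x) from fun h => h2 h.2)])
  all_goals (first
    | (have := hZ h1 h2 h3 hM; omega)
    | (have := hA h1; omega)
    | (have := hB h2; omega)
    | omega)

/-- number of matched index triples: `n³`. -/
lemma sum_matched :
    ∑ x : Fin n × Fin n, ∑ y : Fin n × Fin n, ∑ z : Fin n × Fin n,
      (if (y.1 = x.2 ∧ z = (y.2, x.1)) then 1 else 0) = n ^ 3 := by
  have hz : ∀ x y : Fin n × Fin n, ∑ z : Fin n × Fin n,
      (if (y.1 = x.2 ∧ z = (y.2, x.1)) then 1 else 0) = if y.1 = x.2 then 1 else 0 := by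
    intro x y
    by_cases h : y.1 = x.2
    · simp only [h, true_and, if_true]
      rw [Finset.sum_ite_eq' univ (y.2, x.1) (fun _ => 1)]
      simp
    · simp [h]
  simp only [hz]
  have hy : ∀ x : Fin n × Fin n, ∑ y : Fin n × Fin n, (if y.1 = x.2 then 1 else 0) = n := by
    intro x
    rw [Fintype.sum_prod_type]
    simp only
    rw [Finset.sum_comm]
    simp [Finset.sum_ite_eq', Finset.card_univ]
  simp only [hy, sum_const, card_univ, Fintype.card_prod, Fintype.card_fin, smul_eq_mul]
  ring

/-- UPPER COUNT: a realization has at most `n³ + 3n⁴ + q n²` collinear transversals (with multiplicity). -/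
lemma sum_common₃_le {q : ℕ}
    (hthrough : ∀ p : P, (univ.filter (fun l => inc p l)).card = q + 1)
    (hcommon : ∀ p p' : P, p ≠ p' → (univ.filter (fun l => inc p l ∧ inc p' l)).card = 1)
    (α β γ : Fin n × Fin n → P) (hβ : Function.Injective β) (hγ : Function.Injective γ)
    (hreal : ∀ x y z : Fin n × Fin n, α x ≠ β y → β y ≠ γ z → α x ≠ γ z →
        (∃ l, inc (α x) l ∧ inc (β y) l ∧ inc (γ z) l) → (y.1 = x.2 ∧ z = (y.2, x.1))) :
    ∑ x : Fin n × Fin n, ∑ y : Fin n × Fin n, ∑ z : Fin n × Fin n,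
        (univ.filter (fun l => inc (α x) l ∧ inc (β y) l ∧ inc (γ z) l)).card
      ≤ n ^ 3 + 3 * n ^ 4 + q * n ^ 2 := by
  have hcardX : Fintype.card (Fin n × Fin n) = n ^ 2 := by
    rw [Fintype.card_prod, Fintype.card_fin, sq]
  -- sum the pointwise bound
  have step : ∑ x : Fin n × Fin n, ∑ y : Fin n × Fin n, ∑ z : Fin n × Fin n,
      (univ.filter (fun l => inc (α x) l ∧ inc (β y) l ∧ inc (γ z) l)).card ≤
      ∑ x : Fin n × Fin n, ∑ y : Fin n × Fin n, ∑ z : Fin n × Fin n,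
      ((if (y.1 = x.2 ∧ z = (y.2, x.1)) then 1 else 0) + (if α x = β y then 1 else 0)
      + (if γ z = α x then 1 else 0) + (if γ z = β y then 1 else 0)
      + q * (if (α x = β y ∧ γ z = α x) then 1 else 0)) :=
    sum_le_sum (fun x _ => sum_le_sum (fun y _ => sum_le_sum (fun z _ =>
      common₃_le_indicators inc hthrough hcommon α β γ hreal x y z)))
  refine step.trans ?_
  simp only [sum_add_distrib]
  rw [sum_matched]
  -- term 2: ∑∑∑ [α x = β y] ≤ n^4
  have t2 : ∑ x : Fin n × Fin n, ∑ y : Fin n × Fin n, ∑ z : Fin n × Fin n,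
      (if α x = β y then 1 else 0) ≤ n ^ 4 := by
    calc ∑ x : Fin n × Fin n, ∑ y : Fin n × Fin n, ∑ z : Fin n × Fin n, (if α x = β y then 1 else 0)
        = ∑ x : Fin n × Fin n, ∑ y : Fin n × Fin n, n ^ 2 * (if α x = β y then 1 else 0) := by
          refine sum_congr rfl (fun x _ => sum_congr rfl (fun y _ => ?_))
          rw [sum_const, card_univ, hcardX, smul_eq_mul]
      _ = ∑ x : Fin n × Fin n, n ^ 2 * ∑ y : Fin n × Fin n, (if α x = β y then 1 else 0) := by
          refine sum_congr rfl (fun x _ => ?_); rw [mul_sum]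
      _ ≤ ∑ x : Fin n × Fin n, n ^ 2 * 1 :=
          sum_le_sum (fun x _ => Nat.mul_le_mul_left _ (sum_ind_eq_le_one β hβ (α x)))
      _ = n ^ 4 := by rw [sum_const, card_univ, hcardX, smul_eq_mul]; ring
  -- term 3: ∑∑∑ [γ z = α x] ≤ n^4
  have t3 : ∑ x : Fin n × Fin n, ∑ y : Fin n × Fin n, ∑ z : Fin n × Fin n,
      (if γ z = α x then 1 else 0) ≤ n ^ 4 := by
    calc ∑ x : Fin n × Fin n, ∑ y : Fin n × Fin n, ∑ z : Fin n × Fin n, (if γ z = α x then 1 else 0)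
        = ∑ x : Fin n × Fin n, n ^ 2 * ∑ z : Fin n × Fin n, (if γ z = α x then 1 else 0) := by
          refine sum_congr rfl (fun x _ => ?_)
          rw [sum_const, card_univ, hcardX, smul_eq_mul]
      _ ≤ ∑ x : Fin n × Fin n, n ^ 2 * 1 :=
          sum_le_sum (fun x _ => Nat.mul_le_mul_left _ (sum_ind_eq_le_one' γ hγ (α x)))
      _ = n ^ 4 := by rw [sum_const, card_univ, hcardX, smul_eq_mul]; ring
  -- term 4: ∑∑∑ [γ z = β y] ≤ n^4
  have t4 : ∑ x : Fin n × Fin n, ∑ y : Fin n × Fin n, ∑ z : Fin n × Fin n,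
      (if γ z = β y then 1 else 0) ≤ n ^ 4 := by
    calc ∑ x : Fin n × Fin n, ∑ y : Fin n × Fin n, ∑ z : Fin n × Fin n, (if γ z = β y then 1 else 0)
        = n ^ 2 * ∑ y : Fin n × Fin n, ∑ z : Fin n × Fin n, (if γ z = β y then 1 else 0) := by
          rw [sum_const, card_univ, hcardX, smul_eq_mul]
      _ ≤ n ^ 2 * ∑ y : Fin n × Fin n, 1 :=
          Nat.mul_le_mul_left _ (sum_le_sum (fun y _ => sum_ind_eq_le_one' γ hγ (β y)))
      _ = n ^ 4 := by rw [sum_const, card_univ, hcardX, smul_eq_mul]; ring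
  -- term 5: q * ∑∑∑ [α x = β y ∧ γ z = α x] ≤ q * n^2
  have t5 : ∑ x : Fin n × Fin n, ∑ y : Fin n × Fin n, ∑ z : Fin n × Fin n,
      q * (if (α x = β y ∧ γ z = α x) then 1 else 0) ≤ q * n ^ 2 := by
    have inner : ∀ x : Fin n × Fin n, ∑ y : Fin n × Fin n, ∑ z : Fin n × Fin n,
        (if (α x = β y ∧ γ z = α x) then 1 else 0) ≤ 1 := by
      intro x
      calc ∑ y : Fin n × Fin n, ∑ z : Fin n × Fin n, (if (α x = β y ∧ γ z = α x) then 1 else 0)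
          = (∑ y : Fin n × Fin n, (if α x = β y then 1 else 0)) *
            (∑ z : Fin n × Fin n, (if γ z = α x then 1 else 0)) := by
            rw [sum_mul_sum]
            refine sum_congr rfl (fun y _ => sum_congr rfl (fun z _ => ?_))
            rw [ind_mul_ind]
        _ ≤ 1 * 1 := Nat.mul_le_mul (sum_ind_eq_le_one β hβ (α x)) (sum_ind_eq_le_one' γ hγ (α x))
        _ = 1 := rfl
    calc ∑ x : Fin n × Fin n, ∑ y : Fin n × Fin n, ∑ z : Fin n × Fin n,
          q * (if (α x = β y ∧ γ z = α x) then 1 else 0)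
        = ∑ x : Fin n × Fin n, q * ∑ y : Fin n × Fin n, ∑ z : Fin n × Fin n,
          (if (α x = β y ∧ γ z = α x) then 1 else 0) := by
          refine sum_congr rfl (fun x _ => ?_)
          rw [mul_sum]
          refine sum_congr rfl (fun y _ => ?_)
          rw [mul_sum]
      _ ≤ ∑ x : Fin n × Fin n, q * 1 := sum_le_sum (fun x _ => Nat.mul_le_mul_left _ (inner x))
      _ = q * n ^ 2 := by rw [sum_const, card_univ, hcardX, smul_eq_mul]; ring
  omega

omit [DecidableEq P] in
/-- First and second moments of the line counts of an injective colouring. -/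
lemma moments {q : ℕ}
    (hthrough : ∀ p : P, (univ.filter (fun l => inc p l)).card = q + 1)
    (hcommon : ∀ p p' : P, p ≠ p' → (univ.filter (fun l => inc p l ∧ inc p' l)).card = 1)
    (f : Fin n × Fin n → P) (hf : Function.Injective f) :
    ∑ l : L, (univ.filter (fun x => inc (f x) l)).card = n ^ 2 * (q + 1) ∧
    ∑ l : L, ((univ.filter (fun x => inc (f x) l)).card) ^ 2 = n ^ 2 * (n ^ 2 + q) := by
  have hcardX : Fintype.card (Fin n × Fin n) = n ^ 2 := by
    rw [Fintype.card_prod, Fintype.card_fin, sq]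
  constructor
  · rw [sum_cnt]
    simp only [hthrough, sum_const, card_univ, hcardX, smul_eq_mul]
  · rw [sum_cnt_sq]
    have hx : ∀ x : Fin n × Fin n,
        ∑ x' : Fin n × Fin n, (univ.filter (fun l => inc (f x) l ∧ inc (f x') l)).card = n ^ 2 + q := by
      intro x
      have hpt : ∀ x' : Fin n × Fin n, (univ.filter (fun l => inc (f x) l ∧ inc (f x') l)).card =
          1 + (if x' = x then q else 0) := by
        intro x'
        by_cases h : x' = x
        · rw [if_pos h, h, common₂_self, hthrough]; ring
        · rw [if_neg h, hcommon _ _ (fun e => h (hf e).symm)]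
      simp only [hpt, sum_add_distrib, sum_const, card_univ, hcardX, smul_eq_mul, mul_one,
        Finset.sum_ite_eq', mem_univ, if_true]
    simp only [hx, sum_const, card_univ, hcardX, smul_eq_mul]

end Main

end Summit.MatrixMultiplication.MatrixMultiplication.Theorems.ProjectiveDesign
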